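import Summits.HubbardSuperconductivity.HubbardSuperconductivity.Theses.ComplexGFFStiffness
import Literature.MathematicalPhysics.StatisticalMechanics.AbkmPackageLocalSlots

/-!
# Line `banach_two_kernel` — crux child `TwoKernelSkBound` of route `route-HubbardSuperconductivity-ComplexGFFStiffness`

Crux item stmt-HubbardSuperconductivity-27414 (rank 201; decl
`Summit.HubbardSuperconductivity.HubbardSuperconductivity.Theses.ComplexGFFStiffness.TwoKernelSkBound :=
GradientRG.TwoKernelSkBound 4 ∧ GradientRG.F4l2Shrink 4`), the last open piece under the cruxes
stmt-…-19154 `HypACumulant` / stmt-…-19155 `HypALocalTwoPoint` (route rev 5; the other children and both glue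
items are CLOSED; 27383 `TwoPointGivenZ` and the parents close by the landed closers
`twoPointGivenZ_item_of_cores`, `HypACumulant_of_subs`, `HypALocalTwoPoint_of_subs` once this item holds).
Lead: prover-leafhand-hubbard-cgffstiff-1-g15-0 (2026-08-31), director-hubbard g26 docket (HOME INBOX l.1415).
Honest framing: rung route H2gff / 1c (volume-uniform stiffness of a complex Gaussian gradient field via the
[ABKM19] renormalisation group); nothing here advances superconductivity in the Hubbard model.

## The line
[ABKM19] (arXiv:1910.13564) Lemma 12.6 (12.53) at `ℓ = 1, 2` with `N`-FREE sizes: the two-kernel comparison of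
the irrelevant RG step `S_k^{(q)}(u, v)` (Theorem 6.8) in the tuning parameter `q`.  The tree has (F4l) with an
`N`-DEPENDENT constant (`exists_activityNormLE_rgSQ_sub_of_torusFRD`: Brouwer-grade counting,
`Γ ~ (2^{|Λ|})³(10^{|Λ|})⁴…`, `|Λ| = L^{Nd}`), which is NOT enough.  The line SPLITS OFF everything that is
bookkeeping and isolates the analytic core in its weakest (local) form:

1. LOCALISATION.  The Banach-grade comparison is needed only for `|q − q'|₁ ≤ T₁` (resp. parallelograms with
   sides `|y|₁, |z|₁ ≤ T₂`), thresholds depending on the package but not on `N`: there the comparison kernel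
   `𝒞_{1+q',k+1}` is a small multiplicative perturbation of `𝒞_{1+q,k+1}` shell by shell
   (`abs_re_fourierCoeff_one_add_sub_le_of_torusFRD`, `τ = e^{K|q−q'|₁} − 1`), carries `StepKernelBounds`
   relative to the `q = 0` weights (`stepKernelBounds_const_mul_one_add_of_torusFRD`), and the pair property of
   Lemma 8.4 holds PER CONNECTED POLYMER with an `N`-free constant (`tayNormLE_fluct_sub_fluct_conn_of_torusFRD`,
   p821855; polynomial factor absorbed into `κ ↦ 2^d κ` as in `norm_rgBQ_sub_le_unif_of_torusFRD` p821948).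
   Vocabulary: `GradientRG.F4lLoc / F4l2Loc / TwoKernelSkBoundLoc / F4l2ShrinkLoc`
   (`Literature/…/AbkmPackageLocalSlots.lean`, p826710).
2. FAR FIELD (stubs 3a/3b, size S, LANDED this generation).  For `|q − q'|₁ > T₁` the slot follows from the
   zeroth-order bound `‖S_k^{(q)}(u,v)‖_{k+1} ≤ σ(r)·max(‖u‖, ‖v‖_k)` of Theorem 6.8 twice
   (`isRGStepQ_abkm_of_stepKernelBounds` at the package kernels, `N`-free `σ(r) = sigmaABKM d L R A A_𝒫' r`):
   size `max(l_T, 2σ(r)/T₁)`.  At `ℓ = 2` a parallelogram with a long side is the difference of two first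
   differences along the short side, bounded by (F4l) (for `P.shrink`) twice: size `max(l_TT, 2l_T/T₂)`.
3. THE CORE (stubs 1/2, size L+ each = the honest content of the item).  Stub 1 `TwoKernelSkBoundLoc 4`:
   twins of the Theorem-6.8 contraction files for the SAME `(H, K)` and two step kernels —
   `S^a(H,K)(U) − S^b(H,K)(U) = [blockPart^a − blockPart^b] + ΔΣ₁ + ΔΣ₂ᴸ + ΔΣ₃ + ΔΣ₄`
   (`RenormalisationMapDecompositionABKM.nextKStep_sub_opC_eq` for both data); the block/linear part is LANDED
   `N`-free (`LinearisedMapKernelSubUnifTorusFRD.weakNormLE_opC_sub_unif_of_torusFRD`, p822871); the remainders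
   need two-kernel analogues of `RenormalisationMapRemainderOne/…RemaindersTwoQ/…Three/…Four` in which (i) the
   extracted Hamiltonians `H̃_a = A^aH + B^aK`, `H̃_b` differ by `‖H̃_a − H̃_b‖_{k,0} ≤ (a_T‖H‖ + b_T‖K‖)|q−q'|₁`
   (F4a/F4b, landed `N`-free) — the remainder files already take `H̃, H̃'` as FREE parameters — and (ii) the
   fluctuation operators `R_a, R_b` enter LINEARLY, the difference `(R_a − R_b)F` obeying the per-connected-polymer
   pair bound `≤ τ·ℓ·κ^{|X|_k}‖F‖` (same SHAPE as `tayNormLE_fluct` with `A_𝒫 ↦ κ` and an extra factor `τℓ`), then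
   the weighted (`A^{|U|}`) assembly of `RenormalisationMapLipschitzRaw/Weak` with `C_Δ = 0`, NO gain needed;
   packaging as in `TuningLipschitzSTorusFRD` (local branch only).  Stub 2 `F4l2ShrinkLoc 4`: the same at second
   order (three/four kernels; `ℓ = 2` Gaussian engine `FluctuationKernelComparisonSecond*` landed, g13), states in
   the `P.r/8`-ball so that the mixed `q`/state terms have Cauchy room (SHRINK-DONE-cfgffstiff1-g14 §3); design
   HOME lean/QLIPSCHITZ3-DONE-cgffstiff1-g12-v3.md §3–§4′.  Hint: LINE second differences `S_{q+2h} − 2S_{q+h} + S_q`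
   suffice up to a factor 4 (`ParallelogramSecondDiff.norm_secondDiff_le_bilinear`, p822051, predicate version
   to be written for `activityNormLE`).

v2 (same session, 15:5xZ): stub 1 RESHAPED one level lower — the registered core is now
`stub_twoKernelNextKStepLoc : TwoKernelNextKStepLoc 4` (the local two-kernel bound for the RAW step map `nextKStep` in the
weak norm of scale `k+1`, `AbkmPackageLocalSlots` appendix p827415), and `TwoKernelSkBoundLoc 4` follows by the plumbing stub
`stub_twoKernelSkBoundLoc_of_raw` (landed p827477: `…Theorems/ComplexGFFStiffnessTwoKernelSkBoundRawReduction.lean`).  LANDED towards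
stub 1 (all `--supports 27414`): the LINEAR PART for every package `PackageData.exists_weakNormLE_opC_sub` (p827392), the
large-set margin from `hc3A` (p827098), the Hölder pair (p827118) and the `N`-free size of `H̃^{(q')} − H̃^{(q)}`
(`PackageData.exists_hamNorm_nextH_sub`, p827565: the only `q`-input of the EXISTING free-`H̃` remainder Lipschitz theorems) — so
the open content of stub 1 is exactly the four REMAINDER twins (Σ₁, Σ₂ᴸ, Σ₃, Σ₄; recipe HOME
lean/TWOKERNEL-PLAN-cgffstiff1-g15.md §4) plus `WeakNormLE.add`.

Registrar shape: `twoKernelSkBound_of_stubs : (stub 1) → (stub 2) → (stub 3a) → (stub 3b) → <route decl>` is a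
real proof; the target `TwoKernelSkBound_of` concludes the crux child BY NAME; `sorry` occurs only in the `stub_*`
theorems, whose names and signatures a Theorems file must repeat verbatim (namespace
`Summit.HubbardSuperconductivity.HubbardSuperconductivity.Theorems.ComplexGFF`).  Disproof file: none yet for this
child (`Cruxes/TwoKernelSkBound/` was empty at registration).
-/

noncomputable section

-- `Summit.<Summit>.<Problem>`: single-conjunct summit, the duplicate component is mandated (D-0017).
set_option linter.dupNamespace false

namespace Summit.HubbardSuperconductivity.HubbardSuperconductivity.Theorems.ComplexGFF

open Literature.MathematicalPhysics.StatisticalMechanics.GradientRG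
open Literature.MathematicalPhysics.StatisticalMechanics.TorusPolymer (reblock)
open Literature.MathematicalPhysics.StatisticalMechanics

/-! ## The registered stubs (the ONLY `sorry`s of the file) -/

/-- **Stub 1 — `stub_twoKernelNextKStepLoc` (LANDED p830855, 2026-08-31, prover-leafhand-hubbard-cgffstiff-1-g16:
`Theorems/ComplexGFFStiffnessTwoKernelNextKStepLoc.lean`, `twoKernelNextKStepLoc_all (d) : TwoKernelNextKStepLoc d`).** For every
`d = 4` package an `N`-free size `l_N` and threshold `T₁ > 0` with the LOCAL two-kernel bound for the raw step map:
`‖nextKStep D_q (toHam u) (mulExt v) − nextKStep D_q' (toHam u) (mulExt v)‖_{k+1} ≤ l_N |q − q'|₁ max(‖u‖, c_v)`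
([ABKM19] Lemma 12.6 (12.53) at `ℓ = 1`).  Proof route (memo `Cruxes/HypACumulant/TWOKERNEL-PLAN-27414-v2.md` §1–§8): kernel-only
split `ΔΣᵢ = [Σᵢ(R_a;H̃_a) − Σᵢ(R_a;H̃_b)] + [Σᵢ(R_a;H̃_b) − Σᵢ(R_b;H̃_b)]` (one-kernel Lipschitz files + kernel-only twins p828672,
p828741, p828836, p829297/p829885, p829234), glue/raw/weak p829384/p829860/p829954, pair suppliers p830041, the ROOM
`κ(r)/κ_mid = 1 + Θ(r)` (p829420/p829705/p830091) absorbing the per-block inflation of the Hölder pair, and the package discharge. -/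
theorem stub_twoKernelNextKStepLoc : TwoKernelNextKStepLoc 4 := by
  sorry

/-- **Stub 1b — `stub_twoKernelSkBoundLoc_of_raw` (plumbing; size S; LANDED).** `Q.opS q k u v` is
`restrictConn ∘ nextKStep` on the Theorem-6.8 ball and the weak norm is blind to `restrictConn`. -/
theorem stub_twoKernelSkBoundLoc_of_raw : TwoKernelNextKStepLoc 4 → TwoKernelSkBoundLoc 4 := by
  sorry

/-- Stub 1 of v1 (`TwoKernelSkBoundLoc 4`), now DERIVED from stubs 1 and 1b (bookkeeping). -/
theorem twoKernelSkBoundLoc_of_stubs : TwoKernelSkBoundLoc 4 :=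
  stub_twoKernelSkBoundLoc_of_raw stub_twoKernelNextKStepLoc

/-- **Stub 2′ — `stub_blockB4` (OPEN; v3 reshape 2026-08-31, prover-leafhand-hubbard-cgffstiff-1-g17).** The KERNEL PARALLELOGRAM at the
FIXED intermediate Hamiltonian `H̃_q` (block B4 of the four-corner split `S₁₁ − S₁₀ − S₀₁ + S₀₀ = B1 + B2 + B3 + B4`, memo
`Cruxes/HypACumulant/TWOKERNEL-PLAN-27414-v3.md` §0/§2 R4): for every `d = 4` package with `0 < P.r`, `N`-free `l₄ ≥ 0`, `T₂ > 0` with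
`‖G_{q+y+z}(H̃_q) − G_{q+y}(H̃_q) − G_{q+z}(H̃_q) + G_q(H̃_q)‖_{k+1} ≤ l₄|y|₁|z|₁max(‖u‖,c_v)`,
`G_ρ(Ht) = nextK D_ρ.s π (stepMeasure D_ρ.𝒞) (e^{−toHam u}) (e^{−Ht}) (mulExt v)`.  `nextK` is AFFINE in the fluctuation measure at fixed
`(I, Ĩ, K)`, so this is the second-order KERNEL-ONLY twin programme: the five first-order kernel-only files (p829234 blockPart, p829297/p829885 Σ₁,
p828672 Σ₂ᴸ, p828741 Σ₃/Σ₄) with `fluct 𝒞a F − fluct 𝒞b F` replaced by the four-kernel second difference and the landed ℓ = 2 pair property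
(`tayNormLE_fluct_secondDiff_conn/local_of_torusFRD`) as `hdiff`, the free-`H̃` decomposition (p831667) four times at the common `H̃_q`
(the defect terms combine to an exp second difference of the tied Hamiltonians), glue/weak with room/package as p831851/p832273/p832948.
Blocks B1 (p833412, p833510), B2/B3 (p833227), the uniform bounds U1/U2 (p833279, p832948), the engines (p833074), the assembly modulo B4
(p833574) and the `opS`/`P.shrink` plumbing (`f4l2ShrinkLoc_of_blockB4`) are LANDED. -/
theorem stub_blockB4 :
    ∀ (P : PackageData 4) [Fact (0 < P.h)] [Fact (0 < P.L)], 0 < P.r →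
      ∃ l₄ T₂ : ℝ, 0 ≤ l₄ ∧ 0 < T₂ ∧ ∀ (N M : ℕ) [NeZero M] (Q : PackageAt P N M),
      ∀ q y z : Matrix (Fin 4) (Fin 4) ℝ, P.InBall q → P.InBall (q + y) → P.InBall (q + z) → P.InBall (q + y + z) →
      esum y ≤ T₂ → esum z ≤ T₂ → ∀ k, k + 1 ≤ N →
      ∀ (u : HamSpace ℂ 4 (fieldWt P.h (P.L : ℝ) 4 k) ((P.L : ℝ) ^ k) (P.L ^ (4 * k)))
        (v : activitySpace Q.normParams k) (cv : ℝ), ‖u‖ ≤ P.r →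
        activityNormLE Q.normParams k v cv → cv ≤ P.r →
      WeakNormLE Q.normParams (k + 1)
        (fun X ψ =>
          nextK (abkmStepData P.L P.R k (Q.kernels (q + y + z))).s
              (reblock (abkmStepData P.L P.R k (Q.kernels (q + y + z))).s
                ((abkmStepData P.L P.R k (Q.kernels (q + y + z))).L * (abkmStepData P.L P.R k (Q.kernels (q + y + z))).s))
              (stepMeasure (abkmStepData P.L P.R k (Q.kernels (q + y + z))).𝒞) (expNegH (HamSpace.toHam u))
              (expNegH (nextH (abkmStepData P.L P.R k (Q.kernels q)) (HamSpace.toHam u)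
                (mulExt ((v : activitySpace Q.normParams k) : Finset (Fin 4 → ZMod M) → ((Fin 4 → ZMod M) → ℝ) → ℂ))))
              (mulExt ((v : activitySpace Q.normParams k) : Finset (Fin 4 → ZMod M) → ((Fin 4 → ZMod M) → ℝ) → ℂ)) X ψ -
          nextK (abkmStepData P.L P.R k (Q.kernels (q + y))).s
              (reblock (abkmStepData P.L P.R k (Q.kernels (q + y))).s
                ((abkmStepData P.L P.R k (Q.kernels (q + y))).L * (abkmStepData P.L P.R k (Q.kernels (q + y))).s))
              (stepMeasure (abkmStepData P.L P.R k (Q.kernels (q + y))).𝒞) (expNegH (HamSpace.toHam u))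
              (expNegH (nextH (abkmStepData P.L P.R k (Q.kernels q)) (HamSpace.toHam u)
                (mulExt ((v : activitySpace Q.normParams k) : Finset (Fin 4 → ZMod M) → ((Fin 4 → ZMod M) → ℝ) → ℂ))))
              (mulExt ((v : activitySpace Q.normParams k) : Finset (Fin 4 → ZMod M) → ((Fin 4 → ZMod M) → ℝ) → ℂ)) X ψ -
          nextK (abkmStepData P.L P.R k (Q.kernels (q + z))).s
              (reblock (abkmStepData P.L P.R k (Q.kernels (q + z))).s
                ((abkmStepData P.L P.R k (Q.kernels (q + z))).L * (abkmStepData P.L P.R k (Q.kernels (q + z))).s))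
              (stepMeasure (abkmStepData P.L P.R k (Q.kernels (q + z))).𝒞) (expNegH (HamSpace.toHam u))
              (expNegH (nextH (abkmStepData P.L P.R k (Q.kernels q)) (HamSpace.toHam u)
                (mulExt ((v : activitySpace Q.normParams k) : Finset (Fin 4 → ZMod M) → ((Fin 4 → ZMod M) → ℝ) → ℂ))))
              (mulExt ((v : activitySpace Q.normParams k) : Finset (Fin 4 → ZMod M) → ((Fin 4 → ZMod M) → ℝ) → ℂ)) X ψ +
          nextK (abkmStepData P.L P.R k (Q.kernels q)).s
              (reblock (abkmStepData P.L P.R k (Q.kernels q)).s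
                ((abkmStepData P.L P.R k (Q.kernels q)).L * (abkmStepData P.L P.R k (Q.kernels q)).s))
              (stepMeasure (abkmStepData P.L P.R k (Q.kernels q)).𝒞) (expNegH (HamSpace.toHam u))
              (expNegH (nextH (abkmStepData P.L P.R k (Q.kernels q)) (HamSpace.toHam u)
                (mulExt ((v : activitySpace Q.normParams k) : Finset (Fin 4 → ZMod M) → ((Fin 4 → ZMod M) → ℝ) → ℂ))))
              (mulExt ((v : activitySpace Q.normParams k) : Finset (Fin 4 → ZMod M) → ((Fin 4 → ZMod M) → ℝ) → ℂ)) X ψ)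
        (l₄ * esum y * esum z * max ‖u‖ cv) := by
  sorry

/-- **Stub 2″ — `stub_f4l2ShrinkLoc_of_blockB4` (plumbing, size S; LANDED content: `f4l2ShrinkLoc_of_blockB4`,
`Theorems/ComplexGFFStiffnessF4l2ShrinkLocOfBlockB4.lean`, p833830 — to be re-exported under this name).** B4 for every package with positive
radius implies the local second-difference slot for every shrunk package (four-corner assembly p833574 + `opS`/`P.shrink` plumbing). -/
theorem stub_f4l2ShrinkLoc_of_blockB4 :
    (∀ (P : PackageData 4) [Fact (0 < P.h)] [Fact (0 < P.L)], 0 < P.r →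
      ∃ l₄ T₂ : ℝ, 0 ≤ l₄ ∧ 0 < T₂ ∧ ∀ (N M : ℕ) [NeZero M] (Q : PackageAt P N M),
      ∀ q y z : Matrix (Fin 4) (Fin 4) ℝ, P.InBall q → P.InBall (q + y) → P.InBall (q + z) → P.InBall (q + y + z) →
      esum y ≤ T₂ → esum z ≤ T₂ → ∀ k, k + 1 ≤ N →
      ∀ (u : HamSpace ℂ 4 (fieldWt P.h (P.L : ℝ) 4 k) ((P.L : ℝ) ^ k) (P.L ^ (4 * k)))
        (v : activitySpace Q.normParams k) (cv : ℝ), ‖u‖ ≤ P.r →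
        activityNormLE Q.normParams k v cv → cv ≤ P.r →
      WeakNormLE Q.normParams (k + 1)
        (fun X ψ =>
          nextK (abkmStepData P.L P.R k (Q.kernels (q + y + z))).s
              (reblock (abkmStepData P.L P.R k (Q.kernels (q + y + z))).s
                ((abkmStepData P.L P.R k (Q.kernels (q + y + z))).L * (abkmStepData P.L P.R k (Q.kernels (q + y + z))).s))
              (stepMeasure (abkmStepData P.L P.R k (Q.kernels (q + y + z))).𝒞) (expNegH (HamSpace.toHam u))
              (expNegH (nextH (abkmStepData P.L P.R k (Q.kernels q)) (HamSpace.toHam u)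
                (mulExt ((v : activitySpace Q.normParams k) : Finset (Fin 4 → ZMod M) → ((Fin 4 → ZMod M) → ℝ) → ℂ))))
              (mulExt ((v : activitySpace Q.normParams k) : Finset (Fin 4 → ZMod M) → ((Fin 4 → ZMod M) → ℝ) → ℂ)) X ψ -
          nextK (abkmStepData P.L P.R k (Q.kernels (q + y))).s
              (reblock (abkmStepData P.L P.R k (Q.kernels (q + y))).s
                ((abkmStepData P.L P.R k (Q.kernels (q + y))).L * (abkmStepData P.L P.R k (Q.kernels (q + y))).s))
              (stepMeasure (abkmStepData P.L P.R k (Q.kernels (q + y))).𝒞) (expNegH (HamSpace.toHam u))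
              (expNegH (nextH (abkmStepData P.L P.R k (Q.kernels q)) (HamSpace.toHam u)
                (mulExt ((v : activitySpace Q.normParams k) : Finset (Fin 4 → ZMod M) → ((Fin 4 → ZMod M) → ℝ) → ℂ))))
              (mulExt ((v : activitySpace Q.normParams k) : Finset (Fin 4 → ZMod M) → ((Fin 4 → ZMod M) → ℝ) → ℂ)) X ψ -
          nextK (abkmStepData P.L P.R k (Q.kernels (q + z))).s
              (reblock (abkmStepData P.L P.R k (Q.kernels (q + z))).s
                ((abkmStepData P.L P.R k (Q.kernels (q + z))).L * (abkmStepData P.L P.R k (Q.kernels (q + z))).s))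
              (stepMeasure (abkmStepData P.L P.R k (Q.kernels (q + z))).𝒞) (expNegH (HamSpace.toHam u))
              (expNegH (nextH (abkmStepData P.L P.R k (Q.kernels q)) (HamSpace.toHam u)
                (mulExt ((v : activitySpace Q.normParams k) : Finset (Fin 4 → ZMod M) → ((Fin 4 → ZMod M) → ℝ) → ℂ))))
              (mulExt ((v : activitySpace Q.normParams k) : Finset (Fin 4 → ZMod M) → ((Fin 4 → ZMod M) → ℝ) → ℂ)) X ψ +
          nextK (abkmStepData P.L P.R k (Q.kernels q)).s
              (reblock (abkmStepData P.L P.R k (Q.kernels q)).s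
                ((abkmStepData P.L P.R k (Q.kernels q)).L * (abkmStepData P.L P.R k (Q.kernels q)).s))
              (stepMeasure (abkmStepData P.L P.R k (Q.kernels q)).𝒞) (expNegH (HamSpace.toHam u))
              (expNegH (nextH (abkmStepData P.L P.R k (Q.kernels q)) (HamSpace.toHam u)
                (mulExt ((v : activitySpace Q.normParams k) : Finset (Fin 4 → ZMod M) → ((Fin 4 → ZMod M) → ℝ) → ℂ))))
              (mulExt ((v : activitySpace Q.normParams k) : Finset (Fin 4 → ZMod M) → ((Fin 4 → ZMod M) → ℝ) → ℂ)) X ψ)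
        (l₄ * esum y * esum z * max ‖u‖ cv)) → F4l2ShrinkLoc 4 := by
  sorry

/-- **Stub 2 — `stub_f4l2ShrinkLoc`**, now DERIVED (v3) from `stub_blockB4` and `stub_f4l2ShrinkLoc_of_blockB4`. -/
theorem stub_f4l2ShrinkLoc : F4l2ShrinkLoc 4 :=
  stub_f4l2ShrinkLoc_of_blockB4 stub_blockB4

/-- **Stub 3a — `stub_twoKernelSkBound_of_loc` (far field, first order; size S).** The local `N`-free slot
upgrades to the global one: for `|q − q'|₁ > T₁`, Theorem 6.8 twice gives `2σ(r) ≤ (2σ(r)/T₁)|q − q'|₁`. -/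
theorem stub_twoKernelSkBound_of_loc : TwoKernelSkBoundLoc 4 → TwoKernelSkBound 4 := by
  sorry

/-- **Stub 3b — `stub_f4l2Shrink_of_loc` (far field, second order; size S).** Long parallelograms are differences
of two first differences along the short side, bounded by the global first-order slot for `P.shrink` twice. -/
theorem stub_f4l2Shrink_of_loc : TwoKernelSkBound 4 → F4l2ShrinkLoc 4 → F4l2Shrink 4 := by
  sorry

/-! ## Composition (sorry-free) and the registered target -/

/-- **Composition (kernel-checked, no `sorry` in its own term).** The four stubs imply the crux child — verbatim
the body of `Summit.HubbardSuperconductivity.HubbardSuperconductivity.Theses.ComplexGFFStiffness.TwoKernelSkBound`: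
the first-order far field turns the local bound into `TwoKernelSkBound 4`, which also feeds the second-order far
field. -/
theorem twoKernelSkBound_of_stubs (h₁ : TwoKernelSkBoundLoc 4) (h₂ : F4l2ShrinkLoc 4)
    (h₃ : TwoKernelSkBoundLoc 4 → TwoKernelSkBound 4) (h₄ : TwoKernelSkBound 4 → F4l2ShrinkLoc 4 → F4l2Shrink 4) :
    TwoKernelSkBound 4 ∧ F4l2Shrink 4 :=
  ⟨h₃ h₁, h₄ (h₃ h₁) h₂⟩

/-- **Registered target of the skeleton.** The crux child BY NAME, no hypotheses: `twoKernelSkBound_of_stubs`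
applied to the four declared stubs; `#print axioms TwoKernelSkBound_of` reaches `sorryAx` exactly through the
`stub_*` theorems. -/
theorem TwoKernelSkBound_of :
    Summit.HubbardSuperconductivity.HubbardSuperconductivity.Theses.ComplexGFFStiffness.TwoKernelSkBound :=
  twoKernelSkBound_of_stubs twoKernelSkBoundLoc_of_stubs stub_f4l2ShrinkLoc stub_twoKernelSkBound_of_loc
    stub_f4l2Shrink_of_loc

end Summit.HubbardSuperconductivity.HubbardSuperconductivity.Theorems.ComplexGFF

end
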